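import Literature.NumberTheory.Transcendental.TrdegZariskiDim
import Summits.Schanuel.Schanuel.Theses.RigidCore

/-!
# `RigidCore.SparsityTwo` holds under Schanuel's conjecture in rank 2 (conditional closing certificate, lead c4)

Crux stmt-Schanuel-0971 of route `route-Schanuel-RigidCore`:
`Summit.Schanuel.Schanuel.Theses.RigidCore.SparsityTwo` — a `ℚ`-defined `W ⊆ ℂ² × ℂ²` of `zariskiDim < 2` carries only
finitely many `ℚ`-linearly independent exponential points `(x, eˣ)`.

This file records ON THE ITEM, by name, the upper calibration that the crux disprover (`Cruxes/SparsityTwo/Disproof.lean` §5)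
and the Literature module `TrdegZariskiDim.lean` (p72297) established: the crux is a theorem of SCHANUEL'S CONJECTURE IN RANK 2
(`Literature.NumberTheory.Transcendental.SchanuelRank 2`, an OPEN CONJECTURE recorded as a `def`, not a fact — so this is a
CONDITIONAL result and does not close the item).  Mechanism (`sparsity_of_schanuelRank_two`): a point of a `ℚ`-variety `W` with
`zariskiDim ℂ W < 2` generates a field of transcendence degree `< 2` over `ℚ`, while SC(2) gives `trdeg ℚ(x, eˣ) ≥ 2` for
`ℚ`-independent `x`; so under SC(2) the counted set is EMPTY.  Together with the line's end state
(`Theorems/RigidCoreSparsityTwoWildDepthCap.lean`: `SparsityTwo ↔ WildCuspAtomShallow ∧ InhomogeneousCuspAtomShallow ∧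
LinearCuspAtom`, three open exact-coincidence problems) and the lower calibrations of the Disproof (§2–§3: the crux implies real
Hermite–Lindemann and three kernel-checked open coincidence problems), this brackets the crux: conjecture-grade, between SC(2)
and open Shapiro-type problems.  No sorry; axioms standard; the only hypothesis is the named conjecture.
-/

-- `Summit.Schanuel.Schanuel.…` is the mandated summit/sub-problem namespace (single-conjunct summit), hence:
set_option linter.dupNamespace false

namespace Summit.Schanuel.Schanuel.Theorems

open Literature.NumberTheory.Transcendental

/-- **`SparsityTwo` under SC(2)** (conditional closing certificate for crux stmt-Schanuel-0971): Schanuel's conjecture in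
rank 2 implies `RigidCore.SparsityTwo` — by `Literature.NumberTheory.Transcendental.sparsity_of_schanuelRank_two`
(`TrdegZariskiDim.lean`), the counted set `indepExpPoints W` being definitionally the set in the route decl.  CONDITIONAL on
the open conjecture `SchanuelRank 2`; the unconditional statement is equivalent to three open exact-coincidence problems
(`sparsityTwo_iff_residualAtoms`). -/
theorem SparsityTwo_of_schanuelRank_two (hSC : SchanuelRank 2) :
    Summit.Schanuel.Schanuel.Theses.RigidCore.SparsityTwo := by
  intro W hW hdim
  exact sparsity_of_schanuelRank_two hSC W hW hdim

end Summit.Schanuel.Schanuel.Theorems
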